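import Mathlib.Analysis.InnerProductSpace.PiL2
import Mathlib.Analysis.InnerProductSpace.Orthonormal
import Mathlib.Analysis.Matrix.Order
import Mathlib.LinearAlgebra.Matrix.Trace
import Mathlib.Data.ZMod.Basic
import HarnessLib

/-!
# The sample floor for dihedral coset states (Bacon–Childs–van Dam 2005, Theorem 2)

D. Bacon, A. M. Childs, W. van Dam, *Optimal measurements for the dihedral hidden subgroup
problem*, Chicago J. Theoret. Comput. Sci. 2006, Article 2, arXiv:quant-ph/0501044
[cite: BaconChildsVanDam2005, Thm 2].

## The printed statement

With `k = ν log₂ N` copies of the dihedral coset state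
`ρ_d = (1/N) Σ_x |φ_{x,d}⟩⟨φ_{x,d}|`, `|φ_{x,d}⟩ = (|0,x⟩ + |1,x+d⟩)/√2` (hidden reflection / shift
`d ∈ ℤ/N`), Theorem 2 (p. 9 of the arXiv version) reads: "If `ν ≥ 1 + 4/log N`, then the
probability of successfully determining the order two subgroup is at least `1/8`.  Furthermore, for
any `N` and `k`, the probability of successfully determining the order two subgroup is less than
`2^k/N` (which in particular is exponentially small in `log N` for any fixed `ν < 1`)."  The success
probability is that of a measurement (POVM `{E_d}`) applied to `ρ_d^{⊗k}` with `d` uniform, and by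
Theorem 1 there (Holevo / Yuen–Kennedy–Lax) the pretty good measurement is optimal.

## What is proved here

The SECOND statement, for EVERY measurement: `successProb M ≤ 2^k / N` (`successProb_le`), hence
`p · N ≤ 2^k` samples-versus-success (`samples_floor`): identifying `d` with probability `p` needs
`k ≥ log₂ N - log₂ (1/p)` coset samples whatever the quantum post-processing and whatever its
running time — the information-theoretic floor dual to the Ettinger–Høyer ceiling
(`DihedralHSP.theorem5` in `DihedralHSPSampleComplexity.lean`: `O(log N)` samples suffice
information-theoretically).  The proof is the elementary one: the `N^k` vectors
`|φ_{x⃗,d}⟩ = ⊗_i |φ_{x_i,d}⟩` are orthonormal for fixed `d` (`dot_cosetVec`), so for a positive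
semidefinite effect `E = Bᴴ B` Bessel's inequality gives `Σ_x ⟨φ_x|E|φ_x⟩ ≤ Tr E`
(`sum_expect_le_trace`); summing over `d` with `Σ_d E_d = 1` and `Tr 1 = (2N)^k` gives
`(1/N) · N^{-k} · (2N)^k = 2^k/N`.  (The paper derives the bound from the closed form of the optimal
success probability; the inequality itself is this counting.)  The FIRST statement (`≥ 1/8` at
`ν ≥ 1 + 4/log N`, via Lemma 3 = Regev's Lemma 4.1) and Theorem 4 (even the least significant bit
of `d` needs `ν ≥ 1`) are NOT formalised here and are cited only; no named fact is introduced.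

## Model

`Idx N k = Fin k → Bool × ZMod N` indexes the computational basis of `(ℂ² ⊗ ℂ^N)^{⊗k}`; vectors are
`Idx N k → ℂ`, operators `Matrix (Idx N k) (Idx N k) ℂ`; `cosetVec d x` is the product coset state
with offsets `x : Fin k → ZMod N` (amplitude `2^{-k/2}` on the `2^k` basis states
`s i = (b_i, x_i + b_i d)`); `cosetState d = N^{-k} Σ_x |φ_x⟩⟨φ_x|` is the `k`-register input
with uniformly random offsets (Regev's / Kuperberg's input after the oracle register is discarded
[cite: Kuperberg2005, §2]); a `Measurement` is a POVM indexed by the guesses `d' ∈ ℤ/N`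
(positive semidefinite effects summing to `1`); `successProb` is the Born-rule probability
`(1/N) Σ_d Tr(E_d ρ_d)` of guessing `d` correctly, `d` uniform.  Worst-case offsets (the tree's
`DCP.HasSolution`) are only harder than uniformly random ones for the solver, so the floor applies
a fortiori to any algorithm in the sense of `DihedralCosetProblem.lean`; this file does not
connect the two encodings formally (there: `Fin N` offsets and circuits; here: `ZMod N` and POVMs).

## Main statements

* `dot_cosetVec` : orthonormality of the `N^k` coset vectors for a fixed shift.
* `trace_cosetState` : `Tr ρ_d = 1`.
* `sum_expect_le_trace` : `Σ_x ⟨φ_{x,d}| E |φ_{x,d}⟩ ≤ Tr E` for positive semidefinite `E`.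
* `successProb_le` : BCvD05 Thm 2 (second statement): `successProb M ≤ 2^k / N`.
* `samples_floor` : `p ≤ successProb M → p · N ≤ 2^k`.
-/

namespace Literature.Computability.Cryptography.DCPSampleFloor

open Matrix Finset
open scoped MatrixOrder ComplexOrder InnerProductSpace

noncomputable section

variable {N k : ℕ} [NeZero N]

/-! ### Coset vectors -/

/-- The computational basis of `k` registers `ℂ² ⊗ ℂ^N`: a basis state is `s : Fin k → Bool × ZMod N`,
`s i = (bᵢ, yᵢ)`. [cite: BaconChildsVanDam2005, §2 (eq. for ρ_d^{⊗k})] -/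
abbrev Idx (N k : ℕ) : Type := Fin k → Bool × ZMod N

/-- The real amplitude `2^{-k/2} = (1/√2)^k` of the product coset state. [cite: BaconChildsVanDam2005, §2] -/
def ampR (k : ℕ) : ℝ := (Real.sqrt 2)⁻¹ ^ k

/-- `(2^{-k/2})² = 2^{-k}`. [cite: BaconChildsVanDam2005, §2] -/
theorem ampR_sq (k : ℕ) : ampR k * ampR k = (1 / 2 : ℝ) ^ k := by
  unfold ampR
  rw [← mul_pow, ← pow_two, inv_pow, Real.sq_sqrt (by norm_num : (0 : ℝ) ≤ 2), one_div]

/-- The support pattern of `⊗ᵢ (|0, xᵢ⟩ + |1, xᵢ + d⟩)/√2`: register `i` reads `(b, xᵢ + b·d)`.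
[cite: BaconChildsVanDam2005, §2] -/
def InCoset (d : ZMod N) (x : Fin k → ZMod N) (s : Idx N k) : Prop :=
  ∀ i, (s i).2 = x i + (if (s i).1 then d else 0)

open scoped Classical in
/-- The `k`-register coset vector `|φ_{x,d}⟩ = ⊗ᵢ (|0,xᵢ⟩ + |1,xᵢ+d⟩)/√2` in the computational
basis. [cite: BaconChildsVanDam2005, §2] -/
def cosetVec (d : ZMod N) (x : Fin k → ZMod N) : Idx N k → ℂ :=
  fun s => if InCoset d x s then (ampR k : ℂ) else 0

omit [NeZero N] in
/-- Two offset vectors with a common support point coincide. [cite: BaconChildsVanDam2005, §2] -/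
theorem inCoset_unique {d : ZMod N} {x y : Fin k → ZMod N} {s : Idx N k}
    (hx : InCoset d x s) (hy : InCoset d y s) : x = y := by
  funext i
  have h1 := hx i
  have h2 := hy i
  rw [h1] at h2
  exact add_right_cancel h2

open scoped Classical in
/-- The support of `|φ_{x,d}⟩` has exactly `2^k` basis states (one per control string `b`).
[cite: BaconChildsVanDam2005, §2] -/
theorem card_inCoset (d : ZMod N) (x : Fin k → ZMod N) :
    (univ.filter (InCoset d x)).card = 2 ^ k := by
  classical
  set g : (Fin k → Bool) → Idx N k := fun b i => (b i, x i + if b i then d else 0) with hg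
  have hinj : Function.Injective g := by
    intro b b' h
    funext i
    have := congr_fun h i
    simp only [hg, Prod.mk.injEq] at this
    exact this.1
  have himage : univ.filter (InCoset d x) = univ.image g := by
    ext s
    simp only [mem_filter, mem_univ, true_and, mem_image]
    constructor
    · intro hs
      refine ⟨fun i => (s i).1, ?_⟩
      funext i
      simp only [hg]
      rw [← hs i]
    · rintro ⟨b, rfl⟩ i
      simp [hg]
  rw [himage, card_image_of_injective _ hinj, card_univ, Fintype.card_fun, Fintype.card_bool,
    Fintype.card_fin]

/-- ORTHONORMALITY: `⟨φ_{x,d} | φ_{y,d}⟩ = [x = y]` — the `N^k` coset vectors with a fixed shift are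
orthonormal (disjoint supports for `x ≠ y`, `2^k` entries of modulus `2^{-k/2}` for `x = y`).
[cite: BaconChildsVanDam2005, §2–§3 (ρ_d^{⊗k} block structure)] -/
theorem dot_cosetVec (d : ZMod N) (x y : Fin k → ZMod N) :
    cosetVec d y ⬝ᵥ star (cosetVec d x) = if x = y then 1 else 0 := by
  classical
  unfold cosetVec dotProduct
  simp only [Pi.star_apply]
  by_cases hxy : x = y
  · subst hxy
    rw [if_pos rfl]
    have hterm : ∀ s : Idx N k, (if InCoset d x s then (ampR k : ℂ) else 0) *
        star (if InCoset d x s then (ampR k : ℂ) else 0) =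
        if InCoset d x s then ((ampR k * ampR k : ℝ) : ℂ) else 0 := fun s => by
      split_ifs <;> simp [Complex.conj_ofReal]
    simp_rw [hterm]
    rw [← sum_filter, sum_const, card_inCoset, ampR_sq, nsmul_eq_mul]
    push_cast
    rw [← mul_pow]; norm_num
  · rw [if_neg hxy]
    refine sum_eq_zero fun s _ => ?_
    by_cases hy : InCoset d y s
    · by_cases hx : InCoset d x s
      · exact absurd (inCoset_unique hx hy) hxy
      · simp [hx]
    · simp [hy]

/-- The squared norm of a coset vector is `1`. [cite: BaconChildsVanDam2005, §2] -/
theorem dot_cosetVec_self (d : ZMod N) (x : Fin k → ZMod N) :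
    cosetVec d x ⬝ᵥ star (cosetVec d x) = 1 := by
  rw [dot_cosetVec, if_pos rfl]

/-! ### States, measurements, success probability -/

/-- The `k`-copy input state `ρ_d^{⊗k} = N^{-k} Σ_{x⃗} |φ_{x⃗,d}⟩⟨φ_{x⃗,d}|` (uniformly random offsets,
oracle register discarded). [cite: BaconChildsVanDam2005, §2] -/
def cosetState (d : ZMod N) : Matrix (Idx N k) (Idx N k) ℂ :=
  ((((N : ℝ) ^ k)⁻¹ : ℝ) : ℂ) • ∑ x : Fin k → ZMod N, vecMulVec (cosetVec d x) (star (cosetVec d x))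

/-- `Tr ρ_d = 1`. [cite: BaconChildsVanDam2005, §2] -/
theorem trace_cosetState (d : ZMod N) : trace (cosetState (k := k) d) = 1 := by
  unfold cosetState
  rw [trace_smul, trace_sum]
  simp_rw [trace_vecMulVec, dot_cosetVec_self]
  rw [sum_const, card_univ, Fintype.card_fun, Fintype.card_fin, ZMod.card, smul_eq_mul,
    nsmul_eq_mul, mul_one]
  have hN : (N : ℂ) ≠ 0 := by exact_mod_cast NeZero.ne N
  push_cast
  rw [inv_mul_cancel₀ (pow_ne_zero _ hN)]

/-- A measurement guessing the shift: a POVM `{E_d}_{d ∈ ℤ/N}` on the `k` registers (positive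
semidefinite effects summing to the identity). [cite: BaconChildsVanDam2005, §3 (eq. (povm))] -/
structure Measurement (N k : ℕ) [NeZero N] where
  /-- the effect announcing the guess `d` -/
  effect : ZMod N → Matrix (Idx N k) (Idx N k) ℂ
  /-- effects are positive semidefinite -/
  posSemidef : ∀ d, (effect d).PosSemidef
  /-- effects sum to the identity -/
  sum_effect : ∑ d, effect d = 1

/-- The success probability of `M`: `(1/N) Σ_d Tr(E_d ρ_d)` — the shift `d` uniform, Born rule.
[cite: BaconChildsVanDam2005, §3 (success probability of a measurement)] -/
def successProb (M : Measurement N k) : ℝ :=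
  (N : ℝ)⁻¹ * ∑ d, (trace (M.effect d * cosetState d)).re

/-! ### The trace bound -/

/-- `Tr(E |v⟩⟨v|) = ⟨v| E |v⟩`. [cite: BaconChildsVanDam2005, §3] -/
theorem trace_mul_vecMulVec_star (E : Matrix (Idx N k) (Idx N k) ℂ) (v : Idx N k → ℂ) :
    trace (E * vecMulVec v (star v)) = star v ⬝ᵥ (E *ᵥ v) := by
  simp only [trace, diag_apply, mul_apply, vecMulVec_apply, dotProduct, mulVec, Pi.star_apply,
    mul_sum]
  refine sum_congr rfl fun s _ => sum_congr rfl fun t _ => ?_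
  ring

/-- `⟨u|u⟩ = Σ |uₛ|²` (as a complex number). [cite: BaconChildsVanDam2005, §3] -/
theorem star_dotProduct_self_eq (u : Idx N k → ℂ) :
    star u ⬝ᵥ u = ((∑ s, ‖u s‖ ^ 2 : ℝ) : ℂ) := by
  simp only [dotProduct, Pi.star_apply]
  push_cast
  refine sum_congr rfl fun s _ => ?_
  rw [show star (u s) = (starRingEnd ℂ) (u s) from rfl, Complex.conj_mul']

/-- `Re Tr(Bᴴ B) = Σ_{s,t} |B_{s t}|²` (Frobenius norm). [cite: BaconChildsVanDam2005, §3] -/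
theorem re_trace_conjTranspose_mul_self (B : Matrix (Idx N k) (Idx N k) ℂ) :
    (trace (Bᴴ * B)).re = ∑ s, ∑ t, ‖B s t‖ ^ 2 := by
  simp only [trace, diag_apply, mul_apply, conjTranspose_apply, Complex.re_sum]
  rw [sum_comm]
  refine sum_congr rfl fun s _ => sum_congr rfl fun t _ => ?_
  rw [show star (B s t) = (starRingEnd ℂ) (B s t) from rfl, Complex.conj_mul']
  norm_cast

/-- BESSEL STEP: for a positive semidefinite effect `E` and a fixed shift `d`,
`Σ_x ⟨φ_{x,d}| E |φ_{x,d}⟩ ≤ Tr E` (write `E = Bᴴ B`; then `⟨φ_x|E|φ_x⟩ = ‖B φ_x‖²`, and for each row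
`b_s` of `B`, `Σ_x |⟨b̄_s, φ_x⟩|² ≤ ‖b_s‖²` by Bessel's inequality for the orthonormal family
`(φ_x)_x`). [cite: BaconChildsVanDam2005, Thm 2 (second statement, proof)] -/
theorem sum_expect_le_trace {E : Matrix (Idx N k) (Idx N k) ℂ} (hE : E.PosSemidef) (d : ZMod N) :
    ∑ x : Fin k → ZMod N, (star (cosetVec d x) ⬝ᵥ (E *ᵥ cosetVec d x)).re ≤ (trace E).re := by
  classical
  -- factor `E = Bᴴ B`
  obtain ⟨B, hB⟩ : ∃ B : Matrix (Idx N k) (Idx N k) ℂ, E = Bᴴ * B := by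
    obtain ⟨B, hB⟩ := CStarAlgebra.nonneg_iff_eq_star_mul_self.mp hE.nonneg
    exact ⟨B, by simpa only [star_eq_conjTranspose] using hB⟩
  subst hB
  -- `⟨φ|BᴴB|φ⟩ = Σ_s |(Bφ)_s|²`
  have hquad : ∀ x : Fin k → ZMod N,
      (star (cosetVec d x) ⬝ᵥ ((Bᴴ * B) *ᵥ cosetVec d x)).re = ∑ s, ‖(B *ᵥ cosetVec d x) s‖ ^ 2 := by
    intro x
    rw [← mulVec_mulVec, dotProduct_mulVec, ← star_mulVec, star_dotProduct_self_eq]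
    norm_cast
  simp_rw [hquad]
  rw [re_trace_conjTranspose_mul_self, sum_comm]
  refine sum_le_sum fun s _ => ?_
  -- Bessel for the orthonormal family `x ↦ φ_x` in `EuclideanSpace ℂ (Idx N k)` against the row `s` of `B`
  set v : (Fin k → ZMod N) → EuclideanSpace ℂ (Idx N k) := fun x => WithLp.toLp 2 (cosetVec d x) with hv
  have hon : Orthonormal ℂ v := by
    rw [orthonormal_iff_ite]
    intro x y
    rw [hv, EuclideanSpace.inner_toLp_toLp, dot_cosetVec]
  set w : EuclideanSpace ℂ (Idx N k) := WithLp.toLp 2 (star (B s)) with hw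
  have hbessel := hon.sum_inner_products_le (s := univ) (x := w)
  have hinner : ∀ x, ‖inner ℂ (v x) w‖ = ‖(B *ᵥ cosetVec d x) s‖ := fun x => by
    rw [hv, hw, EuclideanSpace.inner_toLp_toLp, star_dotProduct_star, norm_star, mulVec, dotProduct_comm]
  have hnorm : ‖w‖ ^ 2 = ∑ t, ‖B s t‖ ^ 2 := by
    rw [← inner_self_eq_norm_sq (𝕜 := ℂ), hw, EuclideanSpace.inner_toLp_toLp, star_star,
      star_dotProduct_self_eq]
    norm_cast
  simp_rw [hinner] at hbessel
  rwa [hnorm] at hbessel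

/-! ### Theorem 2 (second statement) -/

/-- BACON–CHILDS–VAN DAM 2005, THEOREM 2 (second statement) [cite: BaconChildsVanDam2005, Thm 2]:
for every `N ≥ 1`, every number of copies `k` and EVERY measurement `M`, the probability of
identifying the hidden shift `d` (uniform) from `k` dihedral coset states is at most `2^k / N`.
It excludes exactly this: no quantum post-processing of any size recovers `d` with probability
`> 2^k/N` from `k` coset samples; it says nothing about running time above the floor, and nothing
about LWE/DCP hardness. -/
theorem successProb_le (M : Measurement N k) : successProb M ≤ 2 ^ k / N := by
  classical
  have hN0 : (0 : ℝ) < N := by exact_mod_cast Nat.pos_of_ne_zero (NeZero.ne N)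
  have hNk : (0 : ℝ) < (N : ℝ) ^ k := pow_pos hN0 k
  -- per-shift bound: `Tr(E_d ρ_d) ≤ N^{-k} Tr(E_d)`
  have hd : ∀ d, (trace (M.effect d * cosetState d)).re ≤ ((N : ℝ) ^ k)⁻¹ * (trace (M.effect d)).re := by
    intro d
    unfold cosetState
    rw [Matrix.mul_smul, trace_smul, Finset.mul_sum, trace_sum, smul_eq_mul, Complex.re_ofReal_mul,
      Complex.re_sum]
    simp_rw [trace_mul_vecMulVec_star]
    exact mul_le_mul_of_nonneg_left (sum_expect_le_trace (M.posSemidef d) d) (by positivity)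
  -- sum over the guesses: `Σ_d Tr E_d = Tr 1 = (2N)^k`
  have hsum : ∑ d, (trace (M.effect d)).re = (2 * N : ℝ) ^ k := by
    rw [← Complex.re_sum, ← trace_sum, M.sum_effect, trace_one, Complex.natCast_re, Fintype.card_fun,
      Fintype.card_prod, Fintype.card_bool, ZMod.card, Fintype.card_fin]
    push_cast
    ring
  have h1 : ∑ d, (trace (M.effect d * cosetState d)).re ≤ ((N : ℝ) ^ k)⁻¹ * (2 * N : ℝ) ^ k := by
    calc ∑ d, (trace (M.effect d * cosetState d)).re
        ≤ ∑ d, ((N : ℝ) ^ k)⁻¹ * (trace (M.effect d)).re :=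
          Finset.sum_le_sum (f := fun d => (trace (M.effect d * cosetState d)).re)
            (g := fun d => ((N : ℝ) ^ k)⁻¹ * (trace (M.effect d)).re) fun d _ => hd d
      _ = ((N : ℝ) ^ k)⁻¹ * (2 * N : ℝ) ^ k := by rw [← Finset.mul_sum, hsum]
  have h2 : ((N : ℝ) ^ k)⁻¹ * (2 * N : ℝ) ^ k = 2 ^ k := by
    rw [mul_pow]; field_simp
  rw [h2] at h1
  unfold successProb
  calc _ ≤ (N : ℝ)⁻¹ * 2 ^ k := mul_le_mul_of_nonneg_left h1 (by positivity)
    _ = 2 ^ k / N := inv_mul_eq_div _ _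

/-- SAMPLE FLOOR [cite: BaconChildsVanDam2005, Thm 2]: success probability `p` from `k` coset
samples forces `p · N ≤ 2^k`, i.e. `k ≥ log₂ N - log₂(1/p)` — for fixed density `ν = k/log₂ N < 1`
the success of ANY measurement is at most `N^{ν-1}`, exponentially small in `log N`. -/
theorem samples_floor (M : Measurement N k) {p : ℝ} (hp : p ≤ successProb M) : p * N ≤ 2 ^ k := by
  have hN0 : (0 : ℝ) < N := by exact_mod_cast Nat.pos_of_ne_zero (NeZero.ne N)
  have h := hp.trans (successProb_le M)
  rwa [le_div_iff₀ hN0] at h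

end

end Literature.Computability.Cryptography.DCPSampleFloor
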